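import Summits.ResolutionOfSingularities.ResolutionOfSingularities.Theorems.DecompositionDescentLU2
import HarnessLib

/-!
# DecompositionDescentLU (3/7) — the witness engine: finitely many standard-étale witnesses with rational residues;
the normalization sandwich; the witness cells

Part 3 of the g27 node `DecompositionDescentLU` of the ROOT/RESIDUAL decomposition cell `decomp-res`
(lens 1, window (W-dec) of critic rows 178/193/202); see the module docstring of
`Summits.ResolutionOfSingularities.ResolutionOfSingularities.Theorems.DecompositionDescentLU` (part 1/7)
for the thesis, the three layers of [CossartPiltant2008, Prop. 9.3], the two currencies of the decomposition
cell (structure: `DecompositionFieldLUAbove`; witnesses: `DecWitnessLUAbove`), the laws, the residual R27, the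
cut and the sources.  Problem side, sorry-free, hypothesis-free.

This part: `exists_div_of_mem_closure`, `isIntegral_of_subring_le`, `finset_subset_decompositionField`, the engine
`exists_finset_regular_below_of_witnesses`, the sandwich `exists_normalization_regular_of_witnesses` (F1 = the tree's
`exists_adjoin_isIntegrallyClosedIn`), and the cells `DecWitnessLUAbove k O` (row 202, witnesses in `K^h`) and
`UnramifiedWitnessLUAbove k O` (verbatim residue-free draft) with `decWitness_le_unramifiedWitness`.
-/

noncomputable section

open IsLocalRing IntermediateField Polynomial Literature.AlgebraicGeometry.Resolution
open scoped Pointwise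

namespace Summit.ResolutionOfSingularities.ResolutionOfSingularities.Theorems.DecompositionDescentLU

universe u

/-! ## PART E — (W-dec) in WITNESS currency (the window cell of critic row 202): standard-étale witnesses over
the MODEL with `K`-rational residues (= witnesses inside the henselization `K^h`); engine for finitely many
witnesses, the normalization sandwich, and THE LAW `DecWitnessLUAbove k O → RelLocalUniformization k K O`,
HYPOTHESIS-FREE (F1 = Noether finiteness and F3 = étale descent of regularity are DISCHARGED in the kernel;
F2′ and ZMT unused) -/

section Engine3

variable {E : Type u} [Field E] (OE : ValuationSubring E) {M : Subfield E}

/-- Elements of the subfield generated by `k` and `t` are fractions of elements of `k[t]`. [folklore] -/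
theorem exists_div_of_mem_closure {k : Type u} [Field k] [Algebra k E] (t : Set E) {z : E}
    (hz : z ∈ Subfield.closure (Set.range (algebraMap k E) ∪ t)) :
    ∃ a ∈ (Algebra.adjoin k t).toSubring, ∃ b ∈ (Algebra.adjoin k t).toSubring, b ≠ 0 ∧ z = a / b := by
  obtain ⟨y, hy, w, hw, hyw⟩ := Subfield.mem_closure_iff.mp hz
  rw [← Algebra.adjoin_eq_ring_closure] at hy hw
  by_cases hw0 : w = 0
  · exact ⟨0, zero_mem _, 1, one_mem _, one_ne_zero, by rw [← hyw, hw0, div_zero, zero_div]⟩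
  · exact ⟨y, hy, w, hw, hw0, hyw.symm⟩

/-- Integrality is monotone in the base subring. [folklore] -/
theorem isIntegral_of_subring_le {B T : Subring E} (hBT : B ≤ T) {x : E} (hx : IsIntegral B x) :
    IsIntegral T x := by
  obtain ⟨p, hp, hpx⟩ := hx
  refine ⟨p.map (Subring.inclusion hBT), hp.map _, ?_⟩
  rw [Polynomial.eval₂_map]
  have : (algebraMap T E).comp (Subring.inclusion hBT) = algebraMap B E := RingHom.ext fun _ => rfl
  rw [this, hpx]

set_option maxHeartbeats 1600000 in
/-- A field generated over `M` by finitely many Hensel roots with `M`-rational residues lies in the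
decomposition field of any Galois `N | M` containing them (`closure_le_decompositionField` root by root). (Sources:
KnafKuhlmann2009, Lemma 3.7.) -/
theorem finset_subset_decompositionField (N : IntermediateField M E) (s : Finset E)
    (hsN : (s : Set E) ⊆ (N : Set E))
    (hs : ∀ x ∈ s, x ∈ OE ∧ (∃ x₀ ∈ M, OE.valuation (x - x₀) < 1) ∧
      ∃ f : E[X], (∀ i, f.coeff i ∈ M) ∧ (∀ i, f.coeff i ∈ OE) ∧ f.eval x = 0 ∧
        OE.valuation ((derivative f).eval x) = 1) :
    Subfield.closure ((M : Set E) ∪ (s : Set E)) ≤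
      (IntermediateField.lift (fixedField (decompositionGroupIn OE N))).toSubfield := by
  refine Subfield.closure_le.mpr ?_
  rintro x (hx | hx)
  · have : algebraMap M E ⟨x, hx⟩ ∈ IntermediateField.lift (fixedField (decompositionGroupIn OE N)) :=
      IntermediateField.algebraMap_mem _ _
    exact this
  · obtain ⟨hxO, ⟨x₀, hx₀, hxx₀⟩, f, hfM, hfO, hfx, hder⟩ := hs x hx
    exact closure_le_decompositionField OE N (hsN hx) hxO hx₀ hxx₀ hfM hfO hfx hder
      (Subfield.subset_closure (Set.mem_union_right _ (Set.mem_singleton x)))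

set_option maxHeartbeats 800000 in
/-- **ENGINE FOR FINITELY MANY WITNESSES ([CoP1] Prop. 9.3, decomposition layer, hypothesis-free in the frame).**
Fix finitely many `M`-integral, `M`-separable generators `gen` of a finite separable top `M(gen)`.  There is a
finite `c ⊆ M ∩ O_E` (Galois-approximation coefficients of the Galois closure `N` of `M(gen)`) such that for
every finite set `s ⊆ M(gen)` of HENSEL ROOTS over `M ∩ O_E` with `M`-rational residues, every field
`M ≤ K′ ≤ M(s)`, every normal affine model `k[t₁] ⊆ M ∩ O_E` of `M` containing `c` and its integral closure
`k[t₁ ∪ t₁′]` in `K′`: if `k[t₁ ∪ t₁′]` is regular at the centre of `O_E`, so is `k[t₁]` (`M(s) ⊆ Z(N)` by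
`finset_subset_decompositionField`; then the tree's (44)(45) and `ringKrullDim_centre_eq_of_isIntegral`). (Sources:
CossartPiltant2008, Prop. 9.3 (HAL pp. 26–28); KnafKuhlmann2009, Lemma 3.7.) -/
theorem exists_finset_regular_below_of_witnesses (k : Type u) [Field k] [Algebra k E]
    (hkM : ∀ c : k, algebraMap k E c ∈ M) [Normal M E] (gen : Finset E)
    (hgen : ∀ x ∈ gen, IsIntegral M x ∧ IsSeparable M x) :
    ∃ c : Finset E, (c : Set E) ⊆ (M : Set E) ∧ (∀ x ∈ c, x ∈ OE) ∧
      ∀ (s : Finset E), (s : Set E) ⊆ (IntermediateField.adjoin M (gen : Set E) : Set E) →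
        (∀ x ∈ s, x ∈ OE ∧ (∃ x₀ ∈ M, OE.valuation (x - x₀) < 1) ∧
          ∃ f : E[X], (∀ i, f.coeff i ∈ M) ∧ (∀ i, f.coeff i ∈ OE) ∧ f.eval x = 0 ∧
            OE.valuation ((derivative f).eval x) = 1) →
      ∀ (K' : Subfield E), M ≤ K' → K' ≤ Subfield.closure ((M : Set E) ∪ (s : Set E)) →
      ∀ (t₁ : Finset E), (t₁ : Set E) ⊆ M →
        M ≤ Subfield.closure (Set.range (algebraMap k E) ∪ (t₁ : Set E)) →
      ∀ (ht₁O : (Algebra.adjoin k (t₁ : Set E)).toSubring ≤ OE.toSubring),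
        (∀ x : E, x ∈ M → IsIntegral (Algebra.adjoin k (t₁ : Set E)) x → x ∈ Algebra.adjoin k (t₁ : Set E)) →
        (c : Set E) ⊆ Algebra.adjoin k (t₁ : Set E) →
      ∀ (t₁' : Finset E), (t₁' : Set E) ⊆ K' →
        (∀ x : E, x ∈ K' → (IsIntegral (Algebra.adjoin k (t₁ : Set E)) x ↔
          x ∈ Algebra.adjoin k ((t₁ : Set E) ∪ (t₁' : Set E)))) →
      ∀ (hO' : (Algebra.adjoin k ((t₁ : Set E) ∪ (t₁' : Set E))).toSubring ≤ OE.toSubring),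
        IsRegularLocalRing (locAtCentre (Algebra.adjoin k ((t₁ : Set E) ∪ (t₁' : Set E))).toSubring OE) →
        IsRegularLocalRing (Localization.AtPrime
          (Ideal.comap (Subring.inclusion ht₁O) (maximalIdeal OE))) := by
  classical
  haveI : Finite (↥(gen : Set E)) := gen.finite_toSet.to_subtype
  let L : IntermediateField M E := IntermediateField.adjoin M (gen : Set E)
  haveI : FiniteDimensional M L :=
    IntermediateField.finiteDimensional_adjoin (fun x hx => (hgen x hx).1)
  haveI : Algebra.IsSeparable M L :=
    (IntermediateField.isSeparable_adjoin_iff_isSeparable M E).mpr (fun x hx => (hgen x hx).2)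
  let N : IntermediateField M E := normalClosure M L E
  haveI : FiniteDimensional M N := normalClosure.is_finiteDimensional M L E
  haveI : Algebra.IsSeparable M N := by
    have h : ∀ g : L →ₐ[M] E, Algebra.IsSeparable M g.fieldRange := fun g =>
      AlgEquiv.Algebra.isSeparable (AlgEquiv.ofInjectiveField g)
    show Algebra.IsSeparable M (normalClosure M L E)
    rw [normalClosure_def]
    infer_instance
  haveI : IsGalois M N := isGalois_iff.mpr ⟨inferInstance, inferInstance⟩
  have hLN : L ≤ N := IntermediateField.le_normalClosure L
  obtain ⟨c, hcM, hcO, hreg⟩ :=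
    exists_finset_isRegularLocalRing_of_regular k (isExcellentRing_of_field k) E OE M hkM N
  refine ⟨c, hcM, hcO, ?_⟩
  intro s hsL hs K' hMK' hK'cl t₁ ht₁M hMcl ht₁O hnorm hct₁ t₁' ht₁'K' hext hO' hreg'
  have hsN : (s : Set E) ⊆ (N : Set E) := fun x hx => hLN (hsL hx)
  have hclN : Subfield.closure ((M : Set E) ∪ (s : Set E)) ≤ N.toSubfield := by
    refine Subfield.closure_le.mpr ?_
    rintro x (hx | hx)
    · exact N.algebraMap_mem ⟨x, hx⟩
    · exact hsN hx
  have hK'N : K' ≤ N.toSubfield := hK'cl.trans hclN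
  have hK'Z : K' ≤ (IntermediateField.lift (fixedField (decompositionGroupIn OE N))).toSubfield :=
    hK'cl.trans (finset_subset_decompositionField OE N s hsN hs)
  have hT'K' : ∀ x ∈ Algebra.adjoin k ((t₁ : Set E) ∪ (t₁' : Set E)), x ∈ K' := by
    intro x hx
    refine (Algebra.adjoin_le (S := { K'.toSubring with algebraMap_mem' := fun c => hMK' (hkM c) }) ?_) hx
    rintro y (hy | hy)
    · exact hMK' (ht₁M hy)
    · exact ht₁'K' hy
  have hintT' : ∀ x ∈ Algebra.adjoin k ((t₁ : Set E) ∪ (t₁' : Set E)),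
      IsIntegral (Algebra.adjoin k (t₁ : Set E)) x := fun x hx => (hext x (hT'K' x hx)).mpr hx
  exact hreg K' hMK' hK'N hK'Z t₁ ht₁M hMcl ht₁O hnorm hct₁ t₁' ht₁'K' hext hO' hreg'
    (ringKrullDim_centre_eq_of_isIntegral OE k t₁ t₁' ht₁O hO' hintT')

/-- **THE NORMALIZATION SANDWICH (layer 1 input from witness data, hypothesis-free; F1 discharged, ZMT unused).**
If the model `k[s]` of `M` (`s ⊆ M ∩ O_E`, `M = Frac k[s]`) with finitely many adjoined `M`-integral,
`M`-separable elements `x′ ⊆ O_E` INTEGRAL OVER `k[s]` is regular at the centre of `O_E`, then the normal model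
`k[t₁] ⊇ k[s]` of `M` (finiteness of normalization, tree `exists_adjoin_isIntegrallyClosedIn`) has integral
closure `k[t₁ ∪ t₁′]` in `M(x′)` (tree `exists_adjoin_eq_integralClosure_extension`) with the SAME local ring at the
centre as `k[s ∪ x′]` (a regular local ring is normal, so it contains `k[t₁ ∪ t₁′]`; conversely `x′` is integral
over `k[t₁]` inside `M(x′)`, so `k[s ∪ x′] ⊆ k[t₁ ∪ t₁′]`), hence regular there. [folklore] (Sources:
CossartPiltant2008, Prop. 9.3 (HAL p. 26).) -/
theorem exists_normalization_regular_of_witnesses (k : Type u) [Field k] [Algebra k E]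
    (hkM : ∀ c : k, algebraMap k E c ∈ M) (hkO : ∀ c : k, algebraMap k E c ∈ OE)
    (s : Finset E) (hsM : (s : Set E) ⊆ M) (hsO : ∀ x ∈ s, x ∈ OE)
    (hMs : M ≤ Subfield.closure (Set.range (algebraMap k E) ∪ (s : Set E)))
    (x' : Finset E) (hx'O : ∀ x ∈ x', x ∈ OE)
    (hx'int : ∀ x ∈ x', IsIntegral M x) (hx'sep : ∀ x ∈ x', IsSeparable M x)
    (hx'intS : ∀ x ∈ x', IsIntegral (Algebra.adjoin k (s : Set E)) x)
    (hreg : IsRegularLocalRing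
      (locAtCentre (Algebra.adjoin k ((s : Set E) ∪ (x' : Set E))).toSubring OE)) :
    ∃ t₁ : Finset E, (t₁ : Set E) ⊆ M ∧ (s : Set E) ⊆ (t₁ : Set E) ∧
      (Algebra.adjoin k (t₁ : Set E)).toSubring ≤ OE.toSubring ∧
      (∀ x ∈ M, IsIntegral (Algebra.adjoin k (t₁ : Set E)) x → x ∈ Algebra.adjoin k (t₁ : Set E)) ∧
      ∃ t₁' : Finset E, (t₁' : Set E) ⊆ (IntermediateField.adjoin M (x' : Set E) : Set E) ∧
        (∀ x ∈ IntermediateField.adjoin M (x' : Set E), IsIntegral (Algebra.adjoin k (t₁ : Set E)) x ↔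
          x ∈ Algebra.adjoin k ((t₁ : Set E) ∪ (t₁' : Set E))) ∧
        ∃ _ : (Algebra.adjoin k ((t₁ : Set E) ∪ (t₁' : Set E))).toSubring ≤ OE.toSubring,
          IsRegularLocalRing (locAtCentre (Algebra.adjoin k ((t₁ : Set E) ∪ (t₁' : Set E))).toSubring OE) := by
  classical
  haveI : IsAdicComplete (maximalIdeal k) k := by
    rw [(isField_iff_maximalIdeal_eq).mp (Field.toIsField k)]; infer_instance
  -- (a) the normal model `k[t₁] ⊇ k[s]` of `M`
  obtain ⟨t₁, hst₁, ht₁M, ht₁int, hnorm⟩ := exists_adjoin_isIntegrallyClosedIn k E M hkM s hsM hMs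
  set B₀ : Subalgebra k E := Algebra.adjoin k (t₁ : Set E) with hB₀def
  set T : Subalgebra k E := Algebra.adjoin k ((s : Set E) ∪ (x' : Set E)) with hTdef
  have hsT : Algebra.adjoin k (s : Set E) ≤ T := Algebra.adjoin_mono Set.subset_union_left
  have hTO : T.toSubring ≤ OE.toSubring := by
    change T ≤ ({ OE.toSubring with algebraMap_mem' := fun c => hkO c } : Subalgebra k E)
    exact Algebra.adjoin_le (Set.union_subset (fun x hx => hsO x hx) (fun x hx => hx'O x hx))
  have hsO' : (Algebra.adjoin k (s : Set E)).toSubring ≤ OE.toSubring := fun x hx => hTO (hsT hx)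
  have hB₀O : B₀.toSubring ≤ OE.toSubring :=
    model_toSubring_le_valuationSubring_of_isIntegral OE hkO (s : Set E) hsO'
      (fun x hx => ht₁int x (Finset.mem_coe.mp hx))
  have hMt₁ : M ≤ Subfield.closure (Set.range (algebraMap k E) ∪ (t₁ : Set E)) :=
    hMs.trans (Subfield.closure_mono (Set.union_subset_union_right _ hst₁))
  -- (b) `K′ = M(x′)`, a finite separable extension of `M`
  haveI : Finite (↥(x' : Set E)) := x'.finite_toSet.to_subtype
  let K'M : IntermediateField M E := IntermediateField.adjoin M (x' : Set E)
  haveI : FiniteDimensional M K'M :=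
    IntermediateField.finiteDimensional_adjoin (fun x hx => hx'int x hx)
  haveI : Algebra.IsSeparable M K'M :=
    (IntermediateField.isSeparable_adjoin_iff_isSeparable M E).mpr (fun x hx => hx'sep x hx)
  let K' : Subfield E := K'M.toSubfield
  have hmemK' : ∀ y : E, y ∈ K' ↔ y ∈ K'M := fun _ => Iff.rfl
  have hrange : Set.range (algebraMap M E) = (M : Set E) := by
    ext z; constructor
    · rintro ⟨w, rfl⟩; exact w.2
    · intro hz; exact ⟨⟨z, hz⟩, rfl⟩
  have hK'cl : ∀ y : E, y ∈ K' ↔ y ∈ Subfield.closure ((M : Set E) ∪ (x' : Set E)) := fun y => by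
    rw [hmemK', ← IntermediateField.mem_toSubfield, IntermediateField.adjoin_toSubfield, hrange]
  have hMK' : ∀ y ∈ M, y ∈ K' := fun y hy => K'M.algebraMap_mem ⟨y, hy⟩
  have hkK' : ∀ c : k, algebraMap k E c ∈ K' := fun c => hMK' _ (hkM c)
  have hx'K' : (x' : Set E) ⊆ (K' : Set E) := fun x hx => IntermediateField.subset_adjoin M _ hx
  -- (c) the integral closure `B = k[t₁ ∪ t₁′]` of `k[t₁]` in `K′`
  obtain ⟨t₁', ht₁'K', hBint, hext⟩ :=
    exists_adjoin_eq_integralClosure_extension k E M hkM K'M t₁ ht₁M hMt₁ hnorm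
  set B : Subalgebra k E := Algebra.adjoin k ((t₁ : Set E) ∪ (t₁' : Set E)) with hBdef
  have hB₀B : B₀ ≤ B := Algebra.adjoin_mono Set.subset_union_left
  -- (d) the upstairs local ring `S′ = k[s ∪ x′]_𝔪` is normal and contains `B`
  set S' : Subring E := locAtCentre T.toSubring OE with hS'def
  have hTK'sub : T.toSubring ≤ K'.toSubring :=
    model_toSubring_le_of_subset hkK' (Set.union_subset (fun x hx => hMK' x (hsM hx)) hx'K')
  have hK'T : K' ≤ Subfield.closure (Set.range (algebraMap k E) ∪ ((s : Set E) ∪ (x' : Set E))) := by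
    intro z hz
    have hz' : z ∈ Subfield.closure ((M : Set E) ∪ (x' : Set E)) := (hK'cl z).mp hz
    refine (Subfield.closure_le.mpr ?_) hz'
    rintro w (hw | hw)
    · exact Subfield.closure_mono (Set.union_subset_union_right _ Set.subset_union_left) (hMs hw)
    · exact Subfield.subset_closure (Or.inr (Or.inr hw))
  have hK'frac : ∀ z ∈ K', ∃ a ∈ T.toSubring, ∃ b ∈ T.toSubring, b ≠ 0 ∧ z = a / b :=
    fun z hz => exists_div_of_mem_closure ((s : Set E) ∪ (x' : Set E)) (hK'T hz)
  have hS'cl : ∀ x ∈ K', IsIntegral S' x → x ∈ S' := fun x hx hxi =>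
    mem_locAtCentre_of_isIntegral T OE hreg K' hTK'sub hK'frac hx hxi
  have hTS' : T.toSubring ≤ S' := le_locAtCentre _ OE
  have hkS' : ∀ c : k, algebraMap k E c ∈ S' := fun c => hTS' (Subalgebra.algebraMap_mem _ c)
  have ht₁S' : ∀ x ∈ (t₁ : Set E), x ∈ S' := fun x hx =>
    hS'cl x (hMK' x (ht₁M hx))
      (isIntegral_of_subring_le (show (Algebra.adjoin k (s : Set E)).toSubring ≤ S' from
        fun y hy => hTS' (hsT hy)) (ht₁int x (Finset.mem_coe.mp hx)))
  have hB₀S' : B₀.toSubring ≤ S' := model_toSubring_le_of_subset hkS' ht₁S'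
  have ht₁'S' : ∀ x ∈ (t₁' : Set E), x ∈ S' := fun x hx =>
    hS'cl x (ht₁'K' hx)
      (isIntegral_of_subring_le hB₀S' (hBint x (Algebra.subset_adjoin (Or.inr hx))))
  have hBS' : B.toSubring ≤ S' :=
    model_toSubring_le_of_subset hkS' (Set.union_subset ht₁S' ht₁'S')
  have hS'O : S' ≤ OE.toSubring := locAtCentre_le hTO
  have hBO : B.toSubring ≤ OE.toSubring := hBS'.trans hS'O
  -- (e) conversely `k[s ∪ x′] ⊆ B`: `x′` is integral over `k[t₁] ⊇ k[s]` inside `K′`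
  have hsB₀ : (Algebra.adjoin k (s : Set E)).toSubring ≤ B₀.toSubring :=
    fun y hy => Algebra.adjoin_mono hst₁ hy
  have hTB : T ≤ B := by
    refine Algebra.adjoin_le (Set.union_subset (fun x hx => hB₀B (Algebra.subset_adjoin (hst₁ hx)))
      (fun x hx => ?_))
    exact hext x (hx'K' hx) (isIntegral_of_subring_le hsB₀ (hx'intS x hx))
  -- (f) `B_𝔪 = S′`, hence regular
  have hge : locAtCentre B.toSubring OE ≤ S' := by
    have h := locAtCentre_mono OE hBS'
    rw [hS'def, locAtCentre_locAtCentre] at h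
    rw [hS'def]; exact h
  have hle : S' ≤ locAtCentre B.toSubring OE := by
    rw [hS'def]; exact locAtCentre_mono OE (show T.toSubring ≤ B.toSubring from fun y hy => hTB hy)
  have hSN : S' = locAtCentre B.toSubring OE := le_antisymm hle hge
  refine ⟨t₁, ht₁M, hst₁, hB₀O, hnorm, t₁', ht₁'K',
    fun x hx => ⟨fun hxi => hext x hx hxi, fun hxB => hBint x hxB⟩, hBO, ?_⟩
  have hreg' : IsRegularLocalRing S' := hreg
  rw [hSN] at hreg'
  exact hreg'

end Engine3

/-! ## PART E (summit frame) — the WITNESS cell `DecWitnessLUAbove k O` and THE LAW, hypothesis-free -/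

section Law3

variable {k K : Type} [Field k] [Field K] [Algebra k K]

variable (k)

/-- **THE CELL `DecWitnessLUAbove k O` — (W-dec) in WITNESS currency (critic row 202, the cell "as drafted",
restricted to what (W-dec) names: witnesses in the HENSELIZATION, i.e. with `K`-rational residues).**  There are a
valuation ring `O_E` of `K̄` above `O` and a FINITE SEPARABLE top `K′ ⊆ K̄` of `K` such that EVERY finitely
generated model `R ⊆ O` of `K | k` admits a finite enlargement `t ⊆ O` and finitely many WITNESSES
`x′ ⊆ K′ ∩ O_E`, each STANDARD-ÉTALE OVER THE MODEL `R[t]` at `O_E` — a root of a MONIC `g ∈ R[t][X]` with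
`v(g′(x′)) = 0` — and with `K`-RATIONAL RESIDUE (`v(x′ − y) > 0` for some `y ∈ K`; equivalently `x′ ∈ K^h`:
the henselization has residue field `κ(O)`), such that the model `R[t][x′]` of `K(x′)` is REGULAR at the
centre of `O_E`.  No residues-in-`k` clause, no group.  For `x′ = ∅` the clause says `R[t]` is regular at the
centre: the cell CONTAINS every place with `RelLocalUniformization k K O` (`decWitnessLUAbove_of_relLU`, said
openly; the content of the law is the genuine tops `K(x′) ≠ K`).  Witnesses WITHOUT the residue clause generate
layers of the STRICT henselization (inertia, `G_Z ≠ G_T`, residue extension) — that is the kind (W-inert) of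
NEXT-g28, not (W-dec) = `K ⊆ K₁ ⊆ K^h` of rows 178/193; see `UnramifiedWitnessLUAbove` below for the verbatim
residue-free cell and `decWitness_le_unramifiedWitness`. (Sources: CossartPiltant2008, Prop. 9.3 and Problem 9.2
(HAL pp. 26–28); KnafKuhlmann2009, Lemma 3.7.) -/
def DecWitnessLUAbove (O : ValuationSubring K) : Prop :=
  ∃ OE : ValuationSubring (AlgebraicClosure K), OE.comap (algebraMap K (AlgebraicClosure K)) = O ∧
  ∃ K' : IntermediateField K (AlgebraicClosure K), FiniteDimensional K K' ∧ Algebra.IsSeparable K K' ∧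
  ∀ R : Subalgebra k K, R.FG → IsFractionRing R K → R.toSubring ≤ O.toSubring →
    ∃ t : Finset K, (∀ x ∈ t, x ∈ O) ∧
    ∃ x' : Finset (AlgebraicClosure K), (x' : Set (AlgebraicClosure K)) ⊆ (K' : Set (AlgebraicClosure K)) ∧
      (∀ x ∈ x', x ∈ OE ∧ (∃ y : K, OE.valuation (x - algebraMap K (AlgebraicClosure K) y) < 1) ∧
        ∃ g : Polynomial K, g.Monic ∧ (∀ i, g.coeff i ∈ Algebra.adjoin k ((R : Set K) ∪ (t : Set K))) ∧
          Polynomial.aeval x g = 0 ∧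
          OE.valuation (Polynomial.aeval x (Polynomial.derivative g)) = 1) ∧
      IsRegularLocalRing (locAtCentre (Algebra.adjoin k
        ((algebraMap K (AlgebraicClosure K)) '' ((R : Set K) ∪ (t : Set K)) ∪
          (x' : Set (AlgebraicClosure K)))).toSubring OE)

/-- **The residue-free witness cell, VERBATIM as drafted in NEXT-g27 / row 202** (`UnramifiedWitnessLUAbove`):
as `DecWitnessLUAbove` but WITHOUT the `K`-rational-residue clause on the witnesses — so the witnesses may
generate INERT unramified layers (`K^h ⊊ K^{sh}`).  Typed here for the record and the probes; its law needs
étale descent of regularity through a residue-field extension ([EGA IV₂ 6.5.1] / [Matsumura, 23.7] with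
[EGA IV₄ 18.10.x]: standard-étale over normal is normal) and is NOT claimed in this node (NEXT-g28, (W-inert)).
(Sources: CossartPiltant2008, Problem 9.2 (HAL p. 26).) -/
def UnramifiedWitnessLUAbove (O : ValuationSubring K) : Prop :=
  ∃ OE : ValuationSubring (AlgebraicClosure K), OE.comap (algebraMap K (AlgebraicClosure K)) = O ∧
  ∃ K' : IntermediateField K (AlgebraicClosure K), FiniteDimensional K K' ∧ Algebra.IsSeparable K K' ∧
  ∀ R : Subalgebra k K, R.FG → IsFractionRing R K → R.toSubring ≤ O.toSubring →
    ∃ t : Finset K, (∀ x ∈ t, x ∈ O) ∧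
    ∃ x' : Finset (AlgebraicClosure K), (x' : Set (AlgebraicClosure K)) ⊆ (K' : Set (AlgebraicClosure K)) ∧
      (∀ x ∈ x', x ∈ OE ∧
        ∃ g : Polynomial K, g.Monic ∧ (∀ i, g.coeff i ∈ Algebra.adjoin k ((R : Set K) ∪ (t : Set K))) ∧
          Polynomial.aeval x g = 0 ∧
          OE.valuation (Polynomial.aeval x (Polynomial.derivative g)) = 1) ∧
      IsRegularLocalRing (locAtCentre (Algebra.adjoin k
        ((algebraMap K (AlgebraicClosure K)) '' ((R : Set K) ∪ (t : Set K)) ∪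
          (x' : Set (AlgebraicClosure K)))).toSubring OE)

variable {k}

/-- The decomposition-witness cell is a face of the residue-free witness cell (forget the residues). [folklore] -/
theorem decWitness_le_unramifiedWitness {O : ValuationSubring K} (h : DecWitnessLUAbove k O) :
    UnramifiedWitnessLUAbove k O := by
  obtain ⟨OE, hOE, K', hfd, hsep, hLU⟩ := h
  refine ⟨OE, hOE, K', hfd, hsep, fun R hR hF hRO => ?_⟩
  obtain ⟨t, htO, x', hx'K', hwit, hreg⟩ := hLU R hR hF hRO
  exact ⟨t, htO, x', hx'K', fun x hx => ⟨(hwit x hx).1, (hwit x hx).2.2⟩, hreg⟩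

end Law3

end Summit.ResolutionOfSingularities.ResolutionOfSingularities.Theorems.DecompositionDescentLU

end
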